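import Literature.NumberTheory.Automorphic.JacquetLanglandsSurjectiveOfTraceComparison
import Literature.NumberTheory.Automorphic.TraceComparisonDatumOfTestAlgebra
import Literature.NumberTheory.Automorphic.SupercuspidalTwoPlaceLocalComponents
import HarnessLib

/-!
# The "onto" half of Jacquet–Langlands, constituent by constituent: from an intertwiner, from a
# Hilbert–Schmidt comparison datum, from a matched `*`-algebra of test functions
(Gelbart, *Automorphic forms on adele groups* (1975), Thm. 10.5 (ii) and its proof, pp. 148–156;
Jacquet–Langlands, LNM 114 (1970), Thm. 16.1 and §16)

Topic `NumberTheory/Automorphic`; theorems only (no definition, no named fact, no instance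
visible to importers). The reductions of the named fact
`jacquetLanglands_transfer_surjective K D` proved in `JacquetLanglandsLocalSatake`,
`JacquetLanglandsLocalComponentsD`, `JacquetLanglandsSurjectiveOfIntertwiner(Generic)` and
`JacquetLanglandsSurjectiveOfTraceComparison` are all of the shape "(for every cuspidal `π`, datum)
→ named fact". Their per-`π` content is isolated here, so that partial results for particular
classes of `π` (e.g. `π` supercuspidal at two places of `Ram(D)`,
`SupercuspidalTwoPlaceLocalComponents`) can be stated with the conclusion of the named fact for
that `π`: `∃ πD ≤ L²(D_𝔸ˣ ⧸ ℝ_{>0} Dˣ)` irreducible, `dim πD ≠ 1`, Hecke-compatible with `π` away from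
every finite `S` through every family of splittings.

* `exists_discreteAutomorphicRep_of_intertwiner` — from a non-zero bounded
  `T : π → L²(D_𝔸ˣ ⧸ ℝ_{>0} Dˣ)` intertwining `GL₂(K_v)` for all `v ∉ Ram_f(D)` (the bodies of
  `jacquetLanglands_transfer_surjective_of_intertwiner'`, `…_of_sharedLocalComponents`,
  `…_of_localComponents`): a constituent `W` with `proj_W ∘ T ≠ 0`, `dim W ≠ 1`
  (`finrank_ne_one_of_intertwiner`), sharing all local components away from `Ram_f(D)`.
* `exists_discreteAutomorphicRep_of_hilbertSchmidtComparison` — from the comparison datum of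
  `jacquetLanglands_transfer_surjective_of_hilbertSchmidtComparison` for this `π`
  (Jacquet–Langlands' Lemma 16.1.1, `exists_intertwiner_adjoint_of_hilbertSchmidt_le`).
* `exists_discreteAutomorphicRep_of_testAlgebra` — from a matched `*`-algebra of test-function
  pairs with the Hilbert–Schmidt trace inequality and one pair non-vanishing on `π`
  (`exists_comparisonDatum_of_testAlgebra`).
* `exists_discreteAutomorphicRep_of_two_supercuspidal` — **the case of `π` supercuspidal at two
  places `v₁ ≠ v₂`** (Gelbart Thm. 10.5 (ii) with (10.15)/Cor. 9.24): the non-vanishing pair is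
  supplied by `exists_localTestFunction₂_integratedOperatorRestrict_ne_zero`
  (`SupercuspidalTwoPlaceLocalComponents`), provided the matched algebra contains the two-place
  product test functions `θ ⊗ ξ₁ ⊗ ξ₂` for supercusp forms `ξ₁`, `ξ₂` and a cofinal family of
  weights `θ` — so that for such `π` only the matched algebra with its trace inequality (the
  comparison (10.14) = (10.15), the transfer `G^S ≅ G'^S` and the local correspondence at `Ram(D)`)
  remains.

No hypothesis on the local components of `π` at `Ram(D)` is needed for these implications (it is
needed to *produce* the data: the non-vanishing on `π` and the comparison itself).

## References

* S. Gelbart, *Automorphic forms on adele groups*, Ann. of Math. Studies 83 (1975), Thm. 10.5 (ii),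
  Lemma 10.6, (10.10)–(10.15) [Gelbart1975].
* H. Jacquet, R. P. Langlands, *Automorphic forms on `GL(2)`*, LNM 114 (1970), §16, Thm. 16.1,
  Lemma 16.1.1 [JacquetLanglands1970].
-/

noncomputable section

open scoped TensorProduct MatrixGroups NNReal ENNReal InnerProductSpace
open NumberField IsDedekindDomain MeasureTheory TopologicalSpace CompactlySupported Filter Topology
open Literature.NumberTheory.Automorphic

universe u

namespace Literature.NumberTheory.Automorphic

section PerConstituent

variable {K : Type} [Field K] [NumberField K] {D : Type u} [Ring D] [Algebra K D]
  [IsQuaternionAlgebra K D]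
  {μ_D : Measure (AdelicGroupData.units K D).automorphicQuotient}
  [(AdelicGroupData.units K D).IsAutomorphicMeasure μ_D]
  {μ : Measure (AdelicGroupData.gl 2 K).automorphicQuotient}
  [(AdelicGroupData.gl 2 K).IsAutomorphicMeasure μ]

/-- **The conclusion of `jacquetLanglands_transfer_surjective` for one cuspidal `π`, from an
intertwiner.** Let `D` be a division quaternion algebra over `K`, `θ₀_v` splittings at the places
`v ∉ Ram_f(D)`, `π` a cuspidal automorphic representation of `GL₂(𝔸_K)` and
`T : π → L²(D_𝔸ˣ ⧸ ℝ_{>0} Dˣ)` a non-zero bounded linear map intertwining `GL₂(K_v)` for every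
`v ∉ Ram_f(D)`. Then some irreducible constituent `πD` of `L²(D_𝔸ˣ ⧸ ℝ_{>0} Dˣ)` (one with
`proj_{πD} ∘ T ≠ 0`) has dimension `≠ 1` and is Hecke-compatible with `π` away from every finite
`S` through every family of splittings (the bodies of
`jacquetLanglands_transfer_surjective_of_intertwiner'`, `…_of_sharedLocalComponents` and
`…_of_localComponents`, for this `π`). [cite: Gelbart1975, Thm. 10.5 (ii) (proof, pp. 151–152)] -/
theorem exists_discreteAutomorphicRep_of_intertwiner
    (θ₀ : ∀ v, v ∉ ramifiedPlaces K D →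
      (ScalarExtension K (v.adicCompletion K) D ≃ₐ[v.adicCompletion K]
        Matrix (Fin 2) (Fin 2) (v.adicCompletion K)))
    (hdiv : ∀ x : D, x ≠ 0 → IsUnit x) (π : CuspidalAutomorphicRepGL 2 K μ)
    (T : π.1.toSubmodule →L[ℂ] (AdelicGroupData.units K D).L2 μ_D) (hT0 : T ≠ 0)
    (hTeq : ∀ (v : HeightOneSpectrum (𝓞 K)) (hv : v ∉ ramifiedPlaces K D)
      (g : GL (Fin 2) (v.adicCompletion K)) (x : π.1.toSubmodule),
      T (π.1.toContRep (GLn.ofLocal 2 K v g) x) =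
        (AdelicGroupData.units K D).rightRegular μ_D
          (Quat.ofLocal K D v ((unitsEquivOfSplitting (θ₀ v hv)).symm g)) (T x)) :
    ∃ πD : DiscreteAutomorphicRep (AdelicGroupData.units K D) μ_D,
      ¬ πD.IsOneDimensional ∧
      ∀ (S : Finset (HeightOneSpectrum (𝓞 K)))
        (φ : ∀ v, v ∉ S → (ScalarExtension K (v.adicCompletion K) D ≃ₐ[v.adicCompletion K]
          Matrix (Fin 2) (Fin 2) (v.adicCompletion K))),
        HeckeCompatibleAway S φ πD π := by
  -- a place outside `Ram_f(D)`
  haveI := infinite_heightOneSpectrum K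
  have hfin : (ramifiedPlaces K D).Finite := ramifiedPlaces_finite_holds K D
  obtain ⟨v₀, hv₀⟩ := hfin.exists_notMem
  -- a vector with non-zero image, and an irreducible constituent seeing it
  obtain ⟨x₀, hx₀⟩ : ∃ x : π.1.toSubmodule, T x ≠ 0 := by
    by_contra h
    push Not at h
    exact hT0 (ContinuousLinearMap.ext h)
  obtain ⟨W, hWirr, hWx₀⟩ :=
    exists_isTopIrreducible_orthogonalProjectionOnto_ne_zero_of_isDiscretelyDecomposable
      (isDiscretelyDecomposable_rightRegular_units K D hdiv μ_D) hx₀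
  let πD : DiscreteAutomorphicRep (AdelicGroupData.units K D) μ_D := ⟨W, hWirr⟩
  -- shared local components away from `Ram_f(D)`
  have hsh : ∀ (v : HeightOneSpectrum (𝓞 K)) (hv : v ∉ ramifiedPlaces K D),
      ∃ (V : Type) (_ : AddCommGroup V) (_ : Module ℂ V)
        (ρ : Representation ℂ (GL (Fin 2) (v.adicCompletion K)) V),
        ρ.IsIrreducible ∧ ρ.IsAdmissible ∧ HasLocalComponentAt π.1 v ρ ∧
          HasLocalComponentAtD (unitsEquivOfSplitting (θ₀ v hv)) πD.space ρ := by
    intro v hv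
    obtain ⟨V₀, _, _, ρ₀, hρ₀i, hρ₀a, hρ₀l⟩ := exists_hasLocalComponentAt_holds π v
    refine ⟨V₀, inferInstance, inferInstance, ρ₀, hρ₀i, hρ₀a, hρ₀l, ?_⟩
    exact hasLocalComponentAtD_of_intertwiner π.1 π.2.2 (unitsEquivOfSplitting (θ₀ v hv)) T
      (hTeq v hv) W ⟨x₀, hWx₀⟩ hρ₀l
  -- the matching of local components through every splitting
  have hloc : ∀ (v : HeightOneSpectrum (𝓞 K))
      (θ : ScalarExtension K (v.adicCompletion K) D ≃ₐ[v.adicCompletion K]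
        Matrix (Fin 2) (Fin 2) (v.adicCompletion K))
      (V : Type u) [AddCommGroup V] [Module ℂ V]
      (ρ : Representation ℂ (GL (Fin 2) (v.adicCompletion K)) V),
      ρ.IsIrreducible → ρ.IsSmooth →
        (HasLocalComponentAt π.1 v ρ ↔
          HasLocalComponentAtD (unitsEquivOfSplitting θ) πD.space ρ) := by
    intro v θ V _ _ ρ hi hs
    have hv : v ∉ ramifiedPlaces K D := fun hr => hr ⟨θ⟩
    obtain ⟨V₀, _, _, ρ₀, hρ₀i, hρ₀a, hρ₀l, hρ₀D⟩ := hsh v hv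
    have hfwd : ∀ (W' : Type u) [AddCommGroup W'] [Module ℂ W']
        (σ : Representation ℂ (GL (Fin 2) (v.adicCompletion K)) W'),
        σ.IsIrreducible → σ.IsSmooth → HasLocalComponentAt π.1 v σ →
          HasLocalComponentAtD (unitsEquivOfSplitting (θ₀ v hv)) πD.space σ :=
      fun W' _ _ σ hσi hσs hσl => hasLocalComponentAtD_of_shared_localComponent π πD
        (unitsEquivOfSplitting (θ₀ v hv)) hρ₀i hρ₀a hρ₀l hρ₀D hσi hσs hσl
    rw [← hasLocalComponentAtD_unitsEquivOfSplitting_iff (θ₀ v hv) θ πD.space ρ]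
    exact ⟨hfwd V ρ hi hs, fun hD => hasLocalComponentAt_of_hasLocalComponentAtD_of_forall π πD
      (unitsEquivOfSplitting (θ₀ v hv)) hfwd hi hs hD⟩
  refine ⟨πD, ?_, fun S φ => heckeCompatibleAway_of_localComponents πD π S φ
    fun v hv V _ _ ρ hi hs => hloc v (φ v hv) V ρ hi hs⟩
  -- `W` is not one-dimensional
  exact finrank_ne_one_of_intertwiner π (unitsEquivOfSplitting (θ₀ v₀ hv₀)) T (hTeq v₀ hv₀) W
    ⟨x₀, hWx₀⟩

/-- **The conclusion of `jacquetLanglands_transfer_surjective` for one cuspidal `π`, from a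
Hilbert–Schmidt comparison datum** (Gelbart (1975), Lemma 10.6 and (10.10); Jacquet–Langlands
(1970), Lemma 16.1.1): Hilbert bases `(b_i)` of `L²(D_𝔸ˣ ⧸ ℝ_{>0} Dˣ)` and `(c_j)` of `π`, a
`ℂ`-subspace `B` of operator pairs closed under products and adjoints and under left
multiplication by the pairs `(R_D(ι_v θ₀_v⁻¹ g), π(ι_v g))`, `v ∉ Ram_f(D)`, with
`Σ_j ‖f₂ c_j‖² ≤ Σ_i ‖f₁ b_i‖² < ∞` on `B` and some `f₂ ≠ 0` (the body of
`jacquetLanglands_transfer_surjective_of_hilbertSchmidtComparison`, for this `π`).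
[cite: Gelbart1975, Thm. 10.5 (ii) (proof), Lemma 10.6, (10.10)] -/
theorem exists_discreteAutomorphicRep_of_hilbertSchmidtComparison
    (θ₀ : ∀ v, v ∉ ramifiedPlaces K D →
      (ScalarExtension K (v.adicCompletion K) D ≃ₐ[v.adicCompletion K]
        Matrix (Fin 2) (Fin 2) (v.adicCompletion K)))
    (hdiv : ∀ x : D, x ≠ 0 → IsUnit x) (π : CuspidalAutomorphicRepGL 2 K μ)
    {ι₁ : Type*} (b : HilbertBasis ι₁ ℂ ((AdelicGroupData.units K D).L2 μ_D))
    {ι₂ : Type*} (c : HilbertBasis ι₂ ℂ π.1.toSubmodule)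
    (B : Submodule ℂ
      (((AdelicGroupData.units K D).L2 μ_D →L[ℂ] (AdelicGroupData.units K D).L2 μ_D) ×
        (π.1.toSubmodule →L[ℂ] π.1.toSubmodule)))
    (hmul : ∀ f ∈ B, ∀ h ∈ B, f * h ∈ B) (hstar : ∀ f ∈ B, star f ∈ B)
    (hG : ∀ (v : HeightOneSpectrum (𝓞 K)) (hv : v ∉ ramifiedPlaces K D)
        (g : GL (Fin 2) (v.adicCompletion K)), ∀ f ∈ B,
      (((AdelicGroupData.units K D).rightRegular μ_D
          (Quat.ofLocal K D v ((unitsEquivOfSplitting (θ₀ v hv)).symm g)),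
        π.1.toContRep (GLn.ofLocal 2 K v g)) :
        ((AdelicGroupData.units K D).L2 μ_D →L[ℂ] (AdelicGroupData.units K D).L2 μ_D) ×
          (π.1.toSubmodule →L[ℂ] π.1.toSubmodule)) * f ∈ B)
    (hHS : ∀ f ∈ B, ∑' j, (‖f.2 (c j)‖₊ : ℝ≥0∞) ^ 2 ≤ ∑' i, (‖f.1 (b i)‖₊ : ℝ≥0∞) ^ 2)
    (hfin : ∀ f ∈ B, ∑' i, (‖f.1 (b i)‖₊ : ℝ≥0∞) ^ 2 < ∞)
    (hne : ∃ f ∈ B, f.2 ≠ 0) :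
    ∃ πD : DiscreteAutomorphicRep (AdelicGroupData.units K D) μ_D,
      ¬ πD.IsOneDimensional ∧
      ∀ (S : Finset (HeightOneSpectrum (𝓞 K)))
        (φ : ∀ v, v ∉ S → (ScalarExtension K (v.adicCompletion K) D ≃ₐ[v.adicCompletion K]
          Matrix (Fin 2) (Fin 2) (v.adicCompletion K))),
        HeckeCompatibleAway S φ πD π := by
  obtain ⟨f₀, hf₀, hf₀0⟩ := hne
  -- the family of local groups outside `Ram_f(D)` and its two unitary actions
  let π₁ : ∀ v : {v : HeightOneSpectrum (𝓞 K) // v ∉ ramifiedPlaces K D},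
      ContRepresentation ℂ (GL (Fin 2) (v.1.adicCompletion K))
        ((AdelicGroupData.units K D).L2 μ_D) :=
    fun v => ((AdelicGroupData.units K D).rightRegular μ_D).restrict
      ((Quat.ofLocal K D v.1).comp (unitsEquivOfSplitting (θ₀ v.1 v.2)).symm.toMonoidHom)
  let π₂ : ∀ v : {v : HeightOneSpectrum (𝓞 K) // v ∉ ramifiedPlaces K D},
      ContRepresentation ℂ (GL (Fin 2) (v.1.adicCompletion K)) π.1.toSubmodule :=
    fun v => π.1.toContRep.restrict (GLn.ofLocal 2 K v.1)
  have hπ₁ : ∀ v, (π₁ v).IsUnitary := fun v g =>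
    (AdelicGroupData.units K D).isUnitary_rightRegular μ_D _
  have hπ₂ : ∀ v, (π₂ v).IsUnitary := fun v g =>
    ((AdelicGroupData.gl 2 K).isUnitary_rightRegular μ).toContRep π.1 _
  have hG' : ∀ (v : {v : HeightOneSpectrum (𝓞 K) // v ∉ ramifiedPlaces K D})
      (g : GL (Fin 2) (v.1.adicCompletion K)), ∀ f ∈ B,
      ((π₁ v g, π₂ v g) :
        ((AdelicGroupData.units K D).L2 μ_D →L[ℂ] (AdelicGroupData.units K D).L2 μ_D) ×
          (π.1.toSubmodule →L[ℂ] π.1.toSubmodule)) * f ∈ B :=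
    fun v g f hf => hG v.1 v.2 g f hf
  have hnd : ∃ f ∈ B, ∃ x ∈ (⊤ : Submodule ℂ π.1.toSubmodule), f.2 x ≠ 0 := by
    obtain ⟨x, hx⟩ : ∃ x, f₀.2 x ≠ 0 := by
      by_contra h
      push Not at h
      exact hf₀0 (ContinuousLinearMap.ext h)
    exact ⟨f₀, hf₀, x, Submodule.mem_top, hx⟩
  obtain ⟨S, ⟨x, -, hSx⟩, hSG, -⟩ := exists_intertwiner_adjoint_of_hilbertSchmidt_le π₁ π₂ hπ₁
    hπ₂ B hmul hstar hG' b c hHS hfin ⊤ isClosed_univ (fun _ _ _ _ => Submodule.mem_top) hnd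
  refine exists_discreteAutomorphicRep_of_intertwiner θ₀ hdiv π S
    (fun h0 => hSx (by rw [h0, zero_apply])) fun v hv g y => ?_
  have h := DFunLike.congr_fun (hSG ⟨v, hv⟩ g) y
  rw [ContinuousLinearMap.comp_apply, ContinuousLinearMap.comp_apply] at h
  exact h

end PerConstituent

/-! ### From a matched `*`-algebra of test functions -/

section TestAlgebra

variable {K : Type} [Field K] [NumberField K] {D : Type u} [Ring D] [Algebra K D]
  [IsQuaternionAlgebra K D]
  {μ_D : Measure (AdelicGroupData.units K D).automorphicQuotient}
  [(AdelicGroupData.units K D).IsAutomorphicMeasure μ_D]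
  {μ : Measure (AdelicGroupData.gl 2 K).automorphicQuotient}
  [(AdelicGroupData.gl 2 K).IsAutomorphicMeasure μ]

attribute [local instance] adelicBorel borelSpace_adelic locallyCompactSpace_adelic
  secondCountableTopology_gl_adelic

/-- **The conclusion of `jacquetLanglands_transfer_surjective` for one cuspidal `π`, from a matched
`*`-algebra of test functions** (Gelbart (1975), §10: (10.10) from (10.12)–(10.15), Lemma 10.6;
Jacquet–Langlands (1970), §16). Let `𝒜 ≤ C_c(D_𝔸ˣ) × C_c(GL₂(𝔸_K))` be a `ℂ`-subspace of pairs
`(Φ', Φ)` closed under the componentwise involution, convolution (for a left-invariant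
inversion-invariant measure `η₁` on `D_𝔸ˣ` and the Haar measure `adelicHaar` of `GL₂(𝔸_K)`) and
left translation by the matched local elements `(ι_v θ₀_v⁻¹ l, ι_v l)`, `v ∉ Ram_f(D)`; let
`(b_i)`, `(e_l)` be Hilbert bases of `L²(D_𝔸ˣ ⧸ ℝ_{>0} Dˣ)`, `L²(GL₂(K) A_G \\ GL₂(𝔸_K))` with the
Hilbert–Schmidt trace inequality `Σ_l ‖R(Φ) e_l‖² ≤ Σ_i ‖R'(Φ') b_i‖² < ∞` on `𝒜` (the comparison
(10.14) = (10.15) of trace formulas, in the sources an equality), and suppose `R(Φ)|_π ≠ 0` for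
some `(Φ', Φ) ∈ 𝒜` (`SupercuspidalPlaceNonvanishing`, `SupercuspidalTwoPlaceLocalComponents`).
Then some irreducible `πD ≤ L²(D_𝔸ˣ ⧸ ℝ_{>0} Dˣ)` of dimension `≠ 1` is Hecke-compatible with `π` away
from every `S` (`exists_comparisonDatum_of_testAlgebra` and
`exists_discreteAutomorphicRep_of_hilbertSchmidtComparison`).
[cite: Gelbart1975, Thm. 10.5 (ii) (proof), (10.10)–(10.15)] -/
theorem exists_discreteAutomorphicRep_of_testAlgebra
    (θ₀ : ∀ v, v ∉ ramifiedPlaces K D →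
      (ScalarExtension K (v.adicCompletion K) D ≃ₐ[v.adicCompletion K]
        Matrix (Fin 2) (Fin 2) (v.adicCompletion K)))
    (hdiv : ∀ x : D, x ≠ 0 → IsUnit x) (π : CuspidalAutomorphicRepGL 2 K μ)
    [MeasurableSpace (AdelicGroupData.units K D).Adelic] [BorelSpace (AdelicGroupData.units K D).Adelic]
    [SecondCountableTopology (AdelicGroupData.units K D).Adelic]
    (η₁ : Measure (AdelicGroupData.units K D).Adelic) [IsFiniteMeasureOnCompacts η₁] [SFinite η₁]
    [η₁.IsMulLeftInvariant] [η₁.IsInvInvariant]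
    (𝒜 : Submodule ℂ (C_c((AdelicGroupData.units K D).Adelic, ℂ) × C_c((AdelicGroupData.gl 2 K).Adelic, ℂ)))
    (hstar : ∀ p ∈ 𝒜, ∃ q ∈ 𝒜, (∀ x, q.1 x = mulStar (⇑p.1) x) ∧ (∀ x, q.2 x = mulStar (⇑p.2) x))
    (hconv : ∀ p ∈ 𝒜, ∀ q ∈ 𝒜, ∃ r ∈ 𝒜, (∀ x, r.1 x = mulConv η₁ (⇑p.1) (⇑q.1) x) ∧
      (∀ x, r.2 x = mulConv (adelicHaar 2 K) (⇑p.2) (⇑q.2) x))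
    (htrans : ∀ (v : HeightOneSpectrum (𝓞 K)) (hv : v ∉ ramifiedPlaces K D)
      (l : GL (Fin 2) (v.adicCompletion K)), ∀ p ∈ 𝒜, ∃ q ∈ 𝒜,
        (∀ x : adelicUnits K D,
          q.1 x = p.1 ((Quat.ofLocal K D v ((unitsEquivOfSplitting (θ₀ v hv)).symm l))⁻¹ * x)) ∧
        (∀ x, q.2 x = p.2 ((GLn.toAdelic 2 K v l)⁻¹ * x)))
    {ι₁ ι₂ : Type*} (b : HilbertBasis ι₁ ℂ ((AdelicGroupData.units K D).L2 μ_D))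
    (e : HilbertBasis ι₂ ℂ ((AdelicGroupData.gl 2 K).L2 μ))
    (hHS : ∀ p ∈ 𝒜,
      ∑' l, (‖((AdelicGroupData.gl 2 K).rightRegular μ).integratedOperator
          ((AdelicGroupData.gl 2 K).isUnitary_rightRegular μ)
          ((AdelicGroupData.gl 2 K).isStronglyContinuous_rightRegular_holds μ) (adelicHaar 2 K)
          p.2 (e l)‖₊ : ℝ≥0∞) ^ 2 ≤
        ∑' i, (‖((AdelicGroupData.units K D).rightRegular μ_D).integratedOperator
          ((AdelicGroupData.units K D).isUnitary_rightRegular μ_D)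
          ((AdelicGroupData.units K D).isStronglyContinuous_rightRegular_holds μ_D) η₁
          p.1 (b i)‖₊ : ℝ≥0∞) ^ 2)
    (hfin : ∀ p ∈ 𝒜,
      ∑' i, (‖((AdelicGroupData.units K D).rightRegular μ_D).integratedOperator
          ((AdelicGroupData.units K D).isUnitary_rightRegular μ_D)
          ((AdelicGroupData.units K D).isStronglyContinuous_rightRegular_holds μ_D) η₁
          p.1 (b i)‖₊ : ℝ≥0∞) ^ 2 < ∞)
    (hne : ∃ p ∈ 𝒜, π.1.integratedOperatorRestrict ((AdelicGroupData.gl 2 K).isUnitary_rightRegular μ)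
      ((AdelicGroupData.gl 2 K).isStronglyContinuous_rightRegular_holds μ) (adelicHaar 2 K) p.2 ≠ 0) :
    ∃ πD : DiscreteAutomorphicRep (AdelicGroupData.units K D) μ_D,
      ¬ πD.IsOneDimensional ∧
      ∀ (S : Finset (HeightOneSpectrum (𝓞 K)))
        (φ : ∀ v, v ∉ S → (ScalarExtension K (v.adicCompletion K) D ≃ₐ[v.adicCompletion K]
          Matrix (Fin 2) (Fin 2) (v.adicCompletion K))),
        HeckeCompatibleAway S φ πD π := by
  haveI : (adelicHaar 2 K).IsInvInvariant := adelicHaar_isInvInvariant 2 K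
  obtain ⟨w₂, c, B, hmulB, hstarB, hGB, hHSB, hfinB, hneB⟩ :=
    exists_comparisonDatum_of_testAlgebra
      ((AdelicGroupData.units K D).isUnitary_rightRegular μ_D)
      ((AdelicGroupData.units K D).isStronglyContinuous_rightRegular_holds μ_D)
      ((AdelicGroupData.gl 2 K).isUnitary_rightRegular μ)
      ((AdelicGroupData.gl 2 K).isStronglyContinuous_rightRegular_holds μ) η₁ (adelicHaar 2 K) π.1
      (𝓥 := {v : HeightOneSpectrum (𝓞 K) // v ∉ ramifiedPlaces K D})
      (L := fun v => GL (Fin 2) (v.1.adicCompletion K))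
      (fun v => ((Quat.ofLocal K D v.1).comp (unitsEquivOfSplitting (θ₀ v.1 v.2)).symm.toMonoidHom :
        GL (Fin 2) (v.1.adicCompletion K) →* (AdelicGroupData.units K D).Adelic))
      (fun v => GLn.toAdelic 2 K v.1) 𝒜 hstar hconv
      (fun v l p hp => htrans v.1 v.2 l p hp) b e hHS hfin hne
  exact exists_discreteAutomorphicRep_of_hilbertSchmidtComparison θ₀ hdiv π b c B hmulB hstarB
    (fun v hv g f hf => hGB ⟨v, hv⟩ g f hf) hHSB hfinB hneB

/-- **The conclusion of `jacquetLanglands_transfer_surjective` for a cuspidal `π` supercuspidal at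
two places, from a matched `*`-algebra of test functions containing the two-place product test
functions** (Gelbart (1975), Thm. 10.5 (ii): proof by the simple trace formula (10.15), which
requires supercusp forms at two places, Cor. 9.24, and pp. 151–156). Let `π` have irreducible
smooth supercuspidal local components `ρ₁` at `v₁` and `ρ₂` at `v₂ ≠ v₁` (`HasLocalComponentAt`;
typically `v₁, v₂ ∈ Ram(D)`), and let `𝒜` be a matched `*`-algebra as in
`exists_discreteAutomorphicRep_of_testAlgebra` (closure properties and the Hilbert–Schmidt trace
inequality) whose second components contain, for all supercusp forms `ξ₁`, `ξ₂` at `v₁`, `v₂` and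
every neighbourhood `N` of `1`, some `θ^{(v₁v₂)} ⊗ ξ₁ ⊗ ξ₂` with `θ ≥ 0` continuous compactly
supported, `θ(1) > 0`, `supp θ ⊆ N`. Then some irreducible `πD ≤ L²(D_𝔸ˣ ⧸ ℝ_{>0} Dˣ)` of dimension
`≠ 1` is Hecke-compatible with `π` away from every `S` — the non-vanishing on `π` being
`exists_localTestFunction₂_integratedOperatorRestrict_ne_zero`.
[cite: Gelbart1975, Thm. 10.5 (ii) (proof, pp. 151–156), Cor. 9.24] -/
theorem exists_discreteAutomorphicRep_of_two_supercuspidal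
    (θ₀ : ∀ v, v ∉ ramifiedPlaces K D →
      (ScalarExtension K (v.adicCompletion K) D ≃ₐ[v.adicCompletion K]
        Matrix (Fin 2) (Fin 2) (v.adicCompletion K)))
    (hdiv : ∀ x : D, x ≠ 0 → IsUnit x) (π : CuspidalAutomorphicRepGL 2 K μ)
    {v₁ v₂ : HeightOneSpectrum (𝓞 K)} (h : v₁ ≠ v₂)
    {V₁ : Type*} [AddCommGroup V₁] [Module ℂ V₁]
    {ρ₁ : Representation ℂ (GL (Fin 2) (v₁.adicCompletion K)) V₁}
    (hρ₁ : ρ₁.IsIrreducible) (hρ₁s : ρ₁.IsSmooth) (hρ₁c : ρ₁.IsSupercuspidal)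
    (hW₁ : HasLocalComponentAt π.1 v₁ ρ₁)
    {V₂ : Type*} [AddCommGroup V₂] [Module ℂ V₂]
    {ρ₂ : Representation ℂ (GL (Fin 2) (v₂.adicCompletion K)) V₂}
    (hρ₂s : ρ₂.IsSmooth) (hρ₂c : ρ₂.IsSupercuspidal) (hW₂ : HasLocalComponentAt π.1 v₂ ρ₂)
    [MeasurableSpace (AdelicGroupData.units K D).Adelic] [BorelSpace (AdelicGroupData.units K D).Adelic]
    [SecondCountableTopology (AdelicGroupData.units K D).Adelic]
    (η₁ : Measure (AdelicGroupData.units K D).Adelic) [IsFiniteMeasureOnCompacts η₁] [SFinite η₁]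
    [η₁.IsMulLeftInvariant] [η₁.IsInvInvariant]
    (𝒜 : Submodule ℂ (C_c((AdelicGroupData.units K D).Adelic, ℂ) × C_c((AdelicGroupData.gl 2 K).Adelic, ℂ)))
    (hstar : ∀ p ∈ 𝒜, ∃ q ∈ 𝒜, (∀ x, q.1 x = mulStar (⇑p.1) x) ∧ (∀ x, q.2 x = mulStar (⇑p.2) x))
    (hconv : ∀ p ∈ 𝒜, ∀ q ∈ 𝒜, ∃ r ∈ 𝒜, (∀ x, r.1 x = mulConv η₁ (⇑p.1) (⇑q.1) x) ∧
      (∀ x, r.2 x = mulConv (adelicHaar 2 K) (⇑p.2) (⇑q.2) x))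
    (htrans : ∀ (v : HeightOneSpectrum (𝓞 K)) (hv : v ∉ ramifiedPlaces K D)
      (l : GL (Fin 2) (v.adicCompletion K)), ∀ p ∈ 𝒜, ∃ q ∈ 𝒜,
        (∀ x : adelicUnits K D,
          q.1 x = p.1 ((Quat.ofLocal K D v ((unitsEquivOfSplitting (θ₀ v hv)).symm l))⁻¹ * x)) ∧
        (∀ x, q.2 x = p.2 ((GLn.toAdelic 2 K v l)⁻¹ * x)))
    {ι₁ ι₂ : Type*} (b : HilbertBasis ι₁ ℂ ((AdelicGroupData.units K D).L2 μ_D))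
    (e : HilbertBasis ι₂ ℂ ((AdelicGroupData.gl 2 K).L2 μ))
    (hHS : ∀ p ∈ 𝒜,
      ∑' l, (‖((AdelicGroupData.gl 2 K).rightRegular μ).integratedOperator
          ((AdelicGroupData.gl 2 K).isUnitary_rightRegular μ)
          ((AdelicGroupData.gl 2 K).isStronglyContinuous_rightRegular_holds μ) (adelicHaar 2 K)
          p.2 (e l)‖₊ : ℝ≥0∞) ^ 2 ≤
        ∑' i, (‖((AdelicGroupData.units K D).rightRegular μ_D).integratedOperator
          ((AdelicGroupData.units K D).isUnitary_rightRegular μ_D)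
          ((AdelicGroupData.units K D).isStronglyContinuous_rightRegular_holds μ_D) η₁
          p.1 (b i)‖₊ : ℝ≥0∞) ^ 2)
    (hfin : ∀ p ∈ 𝒜,
      ∑' i, (‖((AdelicGroupData.units K D).rightRegular μ_D).integratedOperator
          ((AdelicGroupData.units K D).isUnitary_rightRegular μ_D)
          ((AdelicGroupData.units K D).isStronglyContinuous_rightRegular_holds μ_D) η₁
          p.1 (b i)‖₊ : ℝ≥0∞) ^ 2 < ∞)
    (hmem : ∀ (ξ₁ : C_c(GL (Fin 2) (v₁.adicCompletion K), ℂ)) (ξ₂ : C_c(GL (Fin 2) (v₂.adicCompletion K), ℂ)),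
      (∀ k, 0 < k → k < 2 → ∀ [MeasurableSpace (blockNilpotent 2 k (v₁.adicCompletion K))]
        [BorelSpace (blockNilpotent 2 k (v₁.adicCompletion K))]
        (α : Measure (blockNilpotent 2 k (v₁.adicCompletion K))) [α.IsAddHaarMeasure]
        (a b : GL (Fin 2) (v₁.adicCompletion K)),
        ∫ Y, ξ₁ (a * unipotentOfBlock 2 k (v₁.adicCompletion K) (Multiplicative.ofAdd Y) * b) ∂α = 0) →
      (∀ k, 0 < k → k < 2 → ∀ [MeasurableSpace (blockNilpotent 2 k (v₂.adicCompletion K))]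
        [BorelSpace (blockNilpotent 2 k (v₂.adicCompletion K))]
        (α : Measure (blockNilpotent 2 k (v₂.adicCompletion K))) [α.IsAddHaarMeasure]
        (a b : GL (Fin 2) (v₂.adicCompletion K)),
        ∫ Y, ξ₂ (a * unipotentOfBlock 2 k (v₂.adicCompletion K) (Multiplicative.ofAdd Y) * b) ∂α = 0) →
      ∀ N ∈ 𝓝 (1 : (AdelicGroupData.gl 2 K).Adelic),
        ∃ (θ : (AdelicGroupData.gl 2 K).Adelic → ℝ) (hθ : Continuous θ) (hθs : HasCompactSupport θ),
          0 ≤ θ ∧ 0 < θ 1 ∧ Function.support θ ⊆ N ∧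
          ∃ Φ' : C_c((AdelicGroupData.units K D).Adelic, ℂ),
            (Φ', localTestFunction₂Cc h hθ hθs ξ₁.continuous ξ₁.hasCompactSupport ξ₂.continuous
              ξ₂.hasCompactSupport) ∈ 𝒜) :
    ∃ πD : DiscreteAutomorphicRep (AdelicGroupData.units K D) μ_D,
      ¬ πD.IsOneDimensional ∧
      ∀ (S : Finset (HeightOneSpectrum (𝓞 K)))
        (φ : ∀ v, v ∉ S → (ScalarExtension K (v.adicCompletion K) D ≃ₐ[v.adicCompletion K]
          Matrix (Fin 2) (Fin 2) (v.adicCompletion K))),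
        HeckeCompatibleAway S φ πD π := by
  obtain ⟨ξ₁, ξ₂, hξ₁0, hξ₂0, N, hN, hopN⟩ :=
    exists_localTestFunction₂_integratedOperatorRestrict_ne_zero two_pos h π.1 π.2.2 hρ₁ hρ₁s hρ₁c
      hW₁ hρ₂s hρ₂c hW₂
  obtain ⟨θ, hθ, hθs, hθ0, hθ1, hθN, Φ', hmemA⟩ := hmem ξ₁ ξ₂ hξ₁0 hξ₂0 N hN
  exact exists_discreteAutomorphicRep_of_testAlgebra θ₀ hdiv π η₁ 𝒜 hstar hconv htrans b e hHS hfin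
    ⟨_, hmemA, hopN θ hθ hθs hθ0 hθ1 hθN⟩

end TestAlgebra

end Literature.NumberTheory.Automorphic
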